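import Literature.MathematicalPhysics.QuantumLattice.GrassmannCumulantPolarisedGradedDB
import HarnessLib

/-!
# The GRADED truncated step is LIPSCHITZ in the interaction, in TELESCOPED form: one slot carries the difference profile,
# the others the COMMON majorant (determinant-bounded covariances)

Topic `MathematicalPhysics/QuantumLattice`; the polarised twin of `GrassmannEffectiveActionGradedTruncationDB` (one interaction, the
orders `2 ≤ n < N₀` of `effAction C V − e^{Δ_C}V` kept in PRODUCT form on the leg constraint `m + 2(n−1) ≤ Σ_a 2δ_a`) and the graded
refinement of `GrassmannEffectiveActionLipschitzDB` (two interactions, flat), assembled from the polarised graded cumulant bound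
`GrassmannCumulantPolarisedGradedDB.sum_norm_kernel_cumulantOf_sub_le_graded_of_gramBounded` (orders `2 … N₀−1`, telescoped multilinearity:
`𝓔ᵀ(V;n) − 𝓔ᵀ(V′;n) = Σ_a 𝓔ᵀ(V′,…,V′, V−V′, V,…,V)`) and the flat tails of `sum_norm_kernel_effAction_add_sum_cumulant_le_of_gramBounded`
(orders `≥ N₀`, both interactions at the common majorant; Benfatto–Giuliani–Mastropietro 2006, (2.13)–(2.14), (2.77)–(2.80), (2.86)–(2.90);
Gawȩdzki–Kupiainen 1985, §3 — the contraction of the single-scale map in the irrelevant directions is read off this telescoped form):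

* **`sum_norm_kernel_effAction_sub_gaussConv_sub_le_graded_of_gramBounded`** — with `θ = eα‖μ‖_h/κ² < 1`, for every `N₀ ≥ 2` and every degree
  `m ≥ 1`, one output label pinned,
  `Σ_{W : W_i = w} ‖kernel_m ((effAction C V − e^{Δ_C}V) − (effAction C V′ − e^{Δ_C}V′))(W)‖ ≤
     Σ_{n=2}^{N₀−1} ρ^{-m}κ^{-2(n−1)}α^{n−1}eⁿ · Σ_{δ ∈ [0,|Γ|/2]^n, m + 2(n−1) ≤ Σ 2δ_a} Σ_a g_ν(δ_a)·Π_{b ≠ a} g_μ(δ_b) + 2·ρ^{-m} e‖μ‖_h θ^{N₀−1}/(1−θ)`,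
  `g_ν(d) = (e²(κ+ρ))^{2d}ν(d)`, `g_μ(d) = (e²(κ+ρ))^{2d}μ(d)`.

With the degree-`0` sizes `0` the inner sum over `[0,D]^n` is the mixed graded sum `Σ_{δ ∈ [1,D]^n, p+n−1 ≤ Σδ} Σ_a τ^{δ_a}ν(δ_a)·Π_{b≠a} τ^{δ_b}μ(δ_b)`
of a Lipschitz (two-volume / two-cutoff difference) multiscale bookkeeping (cell gate-hubbard-kl, K3 engine child stub (e) rows C1/C2: the
dimensionless consumer is `Summit.….Theorems.EngineV8.towerLipStep_le_of_chernoff`, whose `towerSLip` this is, one output unit pulled out).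

Everything is proved; no definition, no named fact.

## Sources

G. Benfatto, A. Giuliani, V. Mastropietro, Ann. Henri Poincaré 7 (2006) 809–898, (2.13)–(2.14), (2.77)–(2.80), (2.86)–(2.90)
[`BenfattoGiulianiMastropietro2006`]; K. Gawȩdzki, A. Kupiainen, Comm. Math. Phys. 102 (1985) 1–30, §3 [`GawedzkiKupiainen1985GrossNeveu`].
-/

noncomputable section

namespace Literature.MathematicalPhysics.QuantumLattice

open GrassmannAlgebra Finset Literature.Probability.LatticeModels
open scoped InnerProductSpace Nat

universe u

/-! ### The graded Lipschitz step -/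

section GradedLipschitz

variable {𝕜 : Type*} [RCLike 𝕜] {Γ : Type u} [Fintype Γ] [DecidableEq Γ] (C : Matrix Γ Γ 𝕜)

omit [Fintype Γ] [DecidableEq Γ] in
/-- Kernels of a difference. [folklore] -/
private theorem kernel_sub_eq (A B : GrassmannAlgebra 𝕜 Γ) (m : ℕ) (X : Fin m → Γ) :
    kernel 𝕜 (A - B) m X = kernel 𝕜 A m X - kernel 𝕜 B m X := by
  rw [sub_eq_add_neg, kernel_add, ← neg_one_smul 𝕜 B, kernel_smul, neg_one_mul, ← sub_eq_add_neg]

/-- **THE GRADED TRUNCATED STEP IS LIPSCHITZ IN THE INTERACTION, TELESCOPED** (BGM 2006 (2.13)–(2.14), (2.77)–(2.80), (2.86)–(2.90);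
Gawȩdzki–Kupiainen 1985 §3; the polarised twin of `sum_norm_kernel_effAction_sub_gaussConv_le_graded_of_gramBounded`): charged covariance
replica-Gram-bounded with constant `κ`, row/column sums `≤ α`, output weight `ρ`; two even interactions `V`, `V′` without constant part whose
kernels have a COMMON pinned majorant `μ` and whose difference `kernel V − kernel V′` has pinned profile `ν`; `θ = eα‖μ‖_h/κ² < 1`
(`‖μ‖_h = Σ_{m' ≤ |Γ|/2} (e²(κ+ρ))^{2m'} μ(m')`).  Then for every `N₀ ≥ 2` and every degree `m ≥ 1`, one output label pinned,
`Σ_{W : W_i = w} ‖kernel_m ((effAction C V − e^{Δ_C}V) − (effAction C V′ − e^{Δ_C}V′))(W)‖ ≤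
   Σ_{n=2}^{N₀−1} ρ^{-m}κ^{-2(n−1)}α^{n−1}eⁿ · Σ_{δ ∈ [0,|Γ|/2]^n, m + 2(n−1) ≤ Σ 2δ_a} Σ_a g_ν(δ_a)·Π_{b ≠ a} g_μ(δ_b) + 2·ρ^{-m} e‖μ‖_h θ^{N₀−1}/(1−θ)`
— the orders `2 … N₀−1` TELESCOPED (one slot carries the difference profile `ν`, the others the common majorant `μ`) with the leg constraint
kept, the orders `≥ N₀` of both interactions bounded flatly (any tail `→ 0` as `N₀ → ∞` serves the multiscale consumer).
[cite: BenfattoGiulianiMastropietro2006, (2.13)-(2.14) and (2.86)-(2.90)] -/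
theorem sum_norm_kernel_effAction_sub_gaussConv_sub_le_graded_of_gramBounded {κ : ℝ} (hκ : 0 < κ) (hGB : IsGramBoundedR C κ)
    (V V' : GrassmannAlgebra 𝕜 Γ) (hV : V ∈ evenPart 𝕜 Γ) (hV' : V' ∈ evenPart 𝕜 Γ) (hV0 : constPart 𝕜 V = 0)
    (hV'0 : constPart 𝕜 V' = 0) (μ ν : ℕ → ℝ) (hμ0 : ∀ m', 0 ≤ μ m') (hν0 : ∀ m', 0 ≤ ν m')
    (hμ : ∀ m' (j : Fin (2 * m')) (w : Γ), ∑ Y ∈ univ.filter (fun Y : Fin (2 * m') → Γ => Y j = w), ‖kernel 𝕜 V (2 * m') Y‖ ≤ μ m')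
    (hμ' : ∀ m' (j : Fin (2 * m')) (w : Γ), ∑ Y ∈ univ.filter (fun Y : Fin (2 * m') → Γ => Y j = w), ‖kernel 𝕜 V' (2 * m') Y‖ ≤ μ m')
    (hν : ∀ m' (j : Fin (2 * m')) (w : Γ), ∑ Y ∈ univ.filter (fun Y : Fin (2 * m') → Γ => Y j = w),
      ‖kernel 𝕜 V (2 * m') Y - kernel 𝕜 V' (2 * m') Y‖ ≤ ν m')
    {α : ℝ} (hα : 0 < α) (hrow : ∀ X, ∑ Y, ‖C X Y‖ ≤ α) (hcol : ∀ Y, ∑ X, ‖C X Y‖ ≤ α) {ρ : ℝ} (hρ : 0 < ρ)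
    (hθ : Real.exp 1 * α * normV Γ κ ρ μ / κ ^ 2 < 1) {N₀ : ℕ} (hN₀ : 2 ≤ N₀) {m : ℕ} (hm : 0 < m) (i : Fin m) (w : Γ) :
    ∑ W ∈ univ.filter (fun W : Fin m → Γ => W i = w),
        ‖kernel 𝕜 ((effAction 𝕜 C V - gaussConv 𝕜 C V) - (effAction 𝕜 C V' - gaussConv 𝕜 C V')) m W‖ ≤
      ∑ n ∈ Ico 2 N₀, (ρ⁻¹ ^ m * κ⁻¹ ^ (2 * (n - 1)) * (α ^ (n - 1) * Real.exp n)) *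
          ∑ δ ∈ (Fintype.piFinset fun _ : Fin n => range (Fintype.card Γ / 2 + 1)) with m + 2 * (n - 1) ≤ ∑ a, 2 * δ a,
            ∑ a, (Real.exp 2 * (κ + ρ)) ^ (2 * δ a) * ν (δ a) *
              ∏ b ∈ univ.erase a, (Real.exp 2 * (κ + ρ)) ^ (2 * δ b) * μ (δ b) +
        2 * (ρ⁻¹ ^ m * (Real.exp 1 * normV Γ κ ρ μ) *
          (Real.exp 1 * α * normV Γ κ ρ μ / κ ^ 2) ^ (N₀ - 1) / (1 - Real.exp 1 * α * normV Γ κ ρ μ / κ ^ 2)) := by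
  -- notation (as in `sum_norm_kernel_effAction_sub_gaussConv_le_graded_of_gramBounded`)
  set X : evenPart 𝕜 Γ := ⟨-V, neg_mem hV⟩ with hX
  set X' : evenPart 𝕜 Γ := ⟨-V', neg_mem hV'⟩ with hX'
  set degs : Finset ℕ := range (Fintype.card Γ / 2 + 1) with hdegs
  set K : (m' : ℕ) → (Fin (2 * m') → Γ) → 𝕜 := fun m' => kernel 𝕜 (-V) (2 * m') with hK
  set K' : (m' : ℕ) → (Fin (2 * m') → Γ) → 𝕜 := fun m' => kernel 𝕜 (-V') (2 * m') with hK'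
  have hXv : vertexOf 𝕜 degs K = X := Subtype.ext (coe_vertexOf_kernel_eq 𝕜 X)
  have hXv' : vertexOf 𝕜 degs K' = X' := Subtype.ext (coe_vertexOf_kernel_eq 𝕜 X')
  have hKneg : ∀ (A : GrassmannAlgebra 𝕜 Γ) (m' : ℕ) (Y : Fin (2 * m') → Γ), kernel 𝕜 (-A) (2 * m') Y = -kernel 𝕜 A (2 * m') Y := by
    intro A m' Y
    rw [show -A = (-1 : 𝕜) • A from (neg_one_smul 𝕜 A).symm, kernel_smul, neg_one_mul]
  have hKb : ∀ (m' : ℕ) (j : Fin (2 * m')) (w : Γ), ∑ Y ∈ univ.filter (fun Y : Fin (2 * m') → Γ => Y j = w), ‖K m' Y‖ ≤ μ m' := by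
    intro m' j w; simp only [hK, hKneg, norm_neg]; exact hμ m' j w
  have hKb' : ∀ (m' : ℕ) (j : Fin (2 * m')) (w : Γ), ∑ Y ∈ univ.filter (fun Y : Fin (2 * m') → Γ => Y j = w), ‖K' m' Y‖ ≤ μ m' := by
    intro m' j w; simp only [hK', hKneg, norm_neg]; exact hμ' m' j w
  have hDb : ∀ (m' : ℕ) (j : Fin (2 * m')) (w : Γ), ∑ Y ∈ univ.filter (fun Y : Fin (2 * m') → Γ => Y j = w),
      ‖K m' Y - K' m' Y‖ ≤ ν m' := by
    intro m' j w
    simp only [hK, hK', hKneg, ← neg_sub', norm_neg]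
    simpa only [neg_sub] using hν m' j w
  set κs : ℕ → evenPart 𝕜 Γ := fun n => cumulantOf (fun k => evenGaussConv 𝕜 C (X ^ k)) n with hκs
  set κs' : ℕ → evenPart 𝕜 Γ := fun n => cumulantOf (fun k => evenGaussConv 𝕜 C (X' ^ k)) n with hκs'
  have hκs_eq : ∀ n, κs n = cumulantOf (fun k => evenGaussConv 𝕜 C (vertexOf 𝕜 degs K ^ k)) n := fun n => by rw [hXv]
  have hκs'_eq : ∀ n, κs' n = cumulantOf (fun k => evenGaussConv 𝕜 C (vertexOf 𝕜 degs K' ^ k)) n := fun n => by rw [hXv']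
  -- the flat tails at order `N₀`, both at the common majorant
  obtain ⟨-, hbd⟩ := sum_norm_kernel_effAction_add_sum_cumulant_le_of_gramBounded C hκ hGB V hV hV0 μ hμ0 hμ hα
    hrow hcol hρ hθ (n₀ := N₀) (by omega)
  obtain ⟨-, hbd'⟩ := sum_norm_kernel_effAction_add_sum_cumulant_le_of_gramBounded C hκ hGB V' hV' hV'0 μ hμ0 hμ' hα
    hrow hcol hρ hθ (n₀ := N₀) (by omega)
  have htail := hbd hm i w
  have htail' := hbd' hm i w
  -- the polarised graded bound of one cumulant term, with the `1/n!`
  set G : ℕ → ℝ := fun n => (ρ⁻¹ ^ m * κ⁻¹ ^ (2 * (n - 1)) * (α ^ (n - 1) * Real.exp n)) *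
      ∑ δ ∈ (Fintype.piFinset fun _ : Fin n => degs) with m + 2 * (n - 1) ≤ ∑ a, 2 * δ a,
        ∑ a, (Real.exp 2 * (κ + ρ)) ^ (2 * δ a) * ν (δ a) * ∏ b ∈ univ.erase a, (Real.exp 2 * (κ + ρ)) ^ (2 * δ b) * μ (δ b) with hG
  have hterm : ∀ n, 0 < n → ∑ W ∈ univ.filter (fun W : Fin m → Γ => W i = w),
      ‖((n ! : 𝕜))⁻¹ * kernel 𝕜 ((κs n : evenPart 𝕜 Γ) : GrassmannAlgebra 𝕜 Γ) m W -
        ((n ! : 𝕜))⁻¹ * kernel 𝕜 ((κs' n : evenPart 𝕜 Γ) : GrassmannAlgebra 𝕜 Γ) m W‖ ≤ G n := by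
    intro n hn
    have h := sum_norm_kernel_cumulantOf_sub_le_graded_of_gramBounded C hκ hGB degs K K' μ ν hμ0 hν0 hKb hKb' hDb hα hrow hcol hρ hn i w
    rw [← hκs_eq, ← hκs'_eq] at h
    have hfac : (0 : ℝ) < n ! := by positivity
    calc ∑ W ∈ univ.filter (fun W : Fin m → Γ => W i = w),
          ‖((n ! : 𝕜))⁻¹ * kernel 𝕜 ((κs n : evenPart 𝕜 Γ) : GrassmannAlgebra 𝕜 Γ) m W -
            ((n ! : 𝕜))⁻¹ * kernel 𝕜 ((κs' n : evenPart 𝕜 Γ) : GrassmannAlgebra 𝕜 Γ) m W‖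
        = (n ! : ℝ)⁻¹ * ∑ W ∈ univ.filter (fun W : Fin m → Γ => W i = w),
            ‖kernel 𝕜 ((κs n : evenPart 𝕜 Γ) : GrassmannAlgebra 𝕜 Γ) m W - kernel 𝕜 ((κs' n : evenPart 𝕜 Γ) : GrassmannAlgebra 𝕜 Γ) m W‖ := by
          rw [mul_sum]
          exact sum_congr rfl fun W _ => by rw [← mul_sub, norm_mul, norm_inv, RCLike.norm_natCast]
      _ ≤ (n ! : ℝ)⁻¹ * ((n ! : ℝ) * (ρ⁻¹ ^ m * κ⁻¹ ^ (2 * (n - 1)) * (α ^ (n - 1) * Real.exp n)) *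
            ∑ δ ∈ (Fintype.piFinset fun _ : Fin n => degs) with m + 2 * (n - 1) ≤ ∑ a, 2 * δ a,
              ∑ a, (Real.exp 2 * (κ + ρ)) ^ (2 * δ a) * ν (δ a) * ∏ b ∈ univ.erase a, (Real.exp 2 * (κ + ρ)) ^ (2 * δ b) * μ (δ b)) :=
          mul_le_mul_of_nonneg_left h (by positivity)
      _ = G n := by rw [hG]; field_simp
  -- the algebra (twice `hsplit` of the one-interaction theorem)
  have hone : ∀ (Y : evenPart 𝕜 Γ) (A : GrassmannAlgebra 𝕜 Γ), (Y : GrassmannAlgebra 𝕜 Γ) = -A → ∀ W,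
      ((1 ! : 𝕜))⁻¹ * kernel 𝕜 ((cumulantOf (fun k => evenGaussConv 𝕜 C (Y ^ k)) 1 : evenPart 𝕜 Γ) : GrassmannAlgebra 𝕜 Γ) m W =
        -kernel 𝕜 (gaussConv 𝕜 C A) m W := by
    intro Y A hY W
    rw [Nat.factorial_one, Nat.cast_one, inv_one, one_mul, cumulantOf_one]
    simp only [pow_one, coe_evenGaussConv, hY, map_neg]
    rw [show -gaussConv 𝕜 C A = (-1 : 𝕜) • gaussConv 𝕜 C A from (neg_one_smul 𝕜 _).symm, kernel_smul]
    ring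
  have hsplit : ∀ (Y : evenPart 𝕜 Γ) (A : GrassmannAlgebra 𝕜 Γ), (Y : GrassmannAlgebra 𝕜 Γ) = -A → ∀ W,
      kernel 𝕜 (effAction 𝕜 C A - gaussConv 𝕜 C A) m W =
      (kernel 𝕜 (effAction 𝕜 C A) m W + ∑ n ∈ Ico 1 N₀, ((n ! : 𝕜))⁻¹ *
          kernel 𝕜 ((cumulantOf (fun k => evenGaussConv 𝕜 C (Y ^ k)) n : evenPart 𝕜 Γ) : GrassmannAlgebra 𝕜 Γ) m W) -
        ∑ n ∈ Ico 2 N₀, ((n ! : 𝕜))⁻¹ *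
          kernel 𝕜 ((cumulantOf (fun k => evenGaussConv 𝕜 C (Y ^ k)) n : evenPart 𝕜 Γ) : GrassmannAlgebra 𝕜 Γ) m W := by
    intro Y A hY W
    rw [sum_eq_sum_Ico_succ_bot (by omega : 1 < N₀), hone Y A hY W,
      show effAction 𝕜 C A - gaussConv 𝕜 C A = effAction 𝕜 C A + (-1 : 𝕜) • gaussConv 𝕜 C A by rw [neg_one_smul, sub_eq_add_neg],
      kernel_add, kernel_smul]
    ring
  have hXc : (X : GrassmannAlgebra 𝕜 Γ) = -V := rfl
  have hXc' : (X' : GrassmannAlgebra 𝕜 Γ) = -V' := rfl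
  -- abbreviations for the tails
  set T : (Fin m → Γ) → 𝕜 := fun W => kernel 𝕜 (effAction 𝕜 C V) m W + ∑ n ∈ Ico 1 N₀, ((n ! : 𝕜))⁻¹ *
    kernel 𝕜 ((κs n : evenPart 𝕜 Γ) : GrassmannAlgebra 𝕜 Γ) m W with hT
  set T' : (Fin m → Γ) → 𝕜 := fun W => kernel 𝕜 (effAction 𝕜 C V') m W + ∑ n ∈ Ico 1 N₀, ((n ! : 𝕜))⁻¹ *
    kernel 𝕜 ((κs' n : evenPart 𝕜 Γ) : GrassmannAlgebra 𝕜 Γ) m W with hT'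
  have hsplitW : ∀ W, kernel 𝕜 ((effAction 𝕜 C V - gaussConv 𝕜 C V) - (effAction 𝕜 C V' - gaussConv 𝕜 C V')) m W =
      (T W - T' W) - ∑ n ∈ Ico 2 N₀, (((n ! : 𝕜))⁻¹ * kernel 𝕜 ((κs n : evenPart 𝕜 Γ) : GrassmannAlgebra 𝕜 Γ) m W -
        ((n ! : 𝕜))⁻¹ * kernel 𝕜 ((κs' n : evenPart 𝕜 Γ) : GrassmannAlgebra 𝕜 Γ) m W) := by
    intro W
    rw [kernel_sub_eq, hsplit X V hXc W, hsplit X' V' hXc' W, hT, hT', sum_sub_distrib]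
    ring
  set tail : ℝ := ρ⁻¹ ^ m * (Real.exp 1 * normV Γ κ ρ μ) *
    (Real.exp 1 * α * normV Γ κ ρ μ / κ ^ 2) ^ (N₀ - 1) / (1 - Real.exp 1 * α * normV Γ κ ρ μ / κ ^ 2) with htaildef
  -- assemble
  calc ∑ W ∈ univ.filter (fun W : Fin m → Γ => W i = w),
        ‖kernel 𝕜 ((effAction 𝕜 C V - gaussConv 𝕜 C V) - (effAction 𝕜 C V' - gaussConv 𝕜 C V')) m W‖
      ≤ ∑ W ∈ univ.filter (fun W : Fin m → Γ => W i = w), (‖T W‖ + ‖T' W‖ +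
          ∑ n ∈ Ico 2 N₀, ‖((n ! : 𝕜))⁻¹ * kernel 𝕜 ((κs n : evenPart 𝕜 Γ) : GrassmannAlgebra 𝕜 Γ) m W -
            ((n ! : 𝕜))⁻¹ * kernel 𝕜 ((κs' n : evenPart 𝕜 Γ) : GrassmannAlgebra 𝕜 Γ) m W‖) :=
        sum_le_sum fun W _ => by
          rw [hsplitW W]
          exact (norm_sub_le _ _).trans (add_le_add (norm_sub_le _ _) (norm_sum_le _ _))
    _ = ∑ W ∈ univ.filter (fun W : Fin m → Γ => W i = w), ‖T W‖ + ∑ W ∈ univ.filter (fun W : Fin m → Γ => W i = w), ‖T' W‖ +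
          ∑ n ∈ Ico 2 N₀, ∑ W ∈ univ.filter (fun W : Fin m → Γ => W i = w),
            ‖((n ! : 𝕜))⁻¹ * kernel 𝕜 ((κs n : evenPart 𝕜 Γ) : GrassmannAlgebra 𝕜 Γ) m W -
              ((n ! : 𝕜))⁻¹ * kernel 𝕜 ((κs' n : evenPart 𝕜 Γ) : GrassmannAlgebra 𝕜 Γ) m W‖ := by
        rw [sum_add_distrib, sum_add_distrib, sum_comm]
    _ ≤ tail + tail + ∑ n ∈ Ico 2 N₀, G n :=
        add_le_add (add_le_add htail htail') (sum_le_sum fun n hn => hterm n (by have := (mem_Ico.1 hn).1; omega))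
    _ = _ := by rw [hG, htaildef]; ring

end GradedLipschitz

end Literature.MathematicalPhysics.QuantumLattice

end
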